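import Literature.NumberTheory.EllipticCurves.KolyvaginDescentAbstractSystemValueProofs
import Literature.NumberTheory.EllipticCurves.HeegnerPointsKolyvaginPrimaryOrderBoundProofs
import HarnessLib

/-!
# Kolyvagin's descent for an ABSTRACT system of classes, II: the bound on `#(S_{p^M}(E/K)/ℤ δ x₀)`
# (McCallum 1991, §1 Theorem / Thm. 5.4, order form, with the Heegner-point binder replaced by good reduction at the Kolyvagin primes)

Topic `NumberTheory/EllipticCurves`; namespace `Literature.NumberTheory.EllipticCurves`. Theorems only:
**no definition and no named fact is introduced** (D-0026). Sequel of
`KolyvaginDescentAbstractSystemValueProofs` (part I: why the Heegner-point binder of the tree's chain is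
inessential — it is used only for good reduction at the Kolyvagin primes — and the value formula `hCTV`
re-keyed), sibling of `HeegnerPointsKolyvaginPrimaryOrderBoundProofs`, whose assembled theorem
`KolyvaginDescent.card_quotient_selmer_le_of_localTerm` is repeated here VERBATIM (same displayed
inputs, same proof) with `IsHeegnerPoint N₀ W K Pt` replaced by
`hbad : ∀ ℓ, IsKolyvaginPrime N₀ W K p ℓ → λ ∉ badPlaces(E/K)`:

* `KolyvaginDescent.card_quotient_selmer_le_of_localTerm_of_notMemBad` — McCallum's §1 Theorem (order
  form, upper bound) at level `M = 2M₀` for any elliptic `E/ℚ`, any imaginary quadratic `K`, any point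
  `Pt ∈ E(K)` with the displayed Kummer data, and any family of classes `cl` with `cl 1 = δ Pt` and the
  displayed Euler-system properties (A), (B) at the Kolyvagin primes of a level `N₀` at which `E/K` has
  good reduction.

Part III (`KolyvaginDescentAbstractSystemShaBoundProofs`) passes to `Ш(E/K)[p^∞]`. Nothing here is new
mathematics (McCallum §§4–5 for an abstract Euler-system input); nothing on the BSD side is asserted.

## References

* [McCallumLMS1991] W. G. McCallum, *Kolyvagin's work on Shafarevich–Tate groups* (1991), §1
  Theorem, Thm. 4.5, §5 Lemma 5.1, Lemma 5.3, Thm. 5.4, Cor. 5.6.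
* [GrossLMS1991] B. H. Gross, *Kolyvagin's work on modular elliptic curves* (1991), Props. 5.3, 5.4, 10.5.
* [MilneADT2006] J. S. Milne, *Arithmetic Duality Theorems*, 2nd ed. (2006), Ch. I §6, Prop. 6.9,
  Thm. 6.13(a), Rem. 3.5.
-/

noncomputable section

open scoped Classical
open scoped AddSubgroup

universe u

namespace Literature.NumberTheory.EllipticCurves

namespace KolyvaginDescent

open CategoryTheory _root_.WeierstrassCurve Field Function NumberField IsDedekindDomain
open Literature.NumberTheory.GaloisRepresentations Literature.NumberTheory.GaloisCohomology
open Literature.NumberTheory.GaloisRepresentations.DiscreteGaloisModule (mu MuCarrier pairing)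
open Literature.GroupTheory.FiniteAbelian
open scoped ContRepresentation

-- Cup products need `LocallyCompactSpace Γ`; as in the tree's cup-product files, the compactness of
-- absolute Galois groups is a local instance only.
attribute [local instance] absoluteGaloisGroup_compactSpace

-- `char K_v = 0` for the completions of a number field (local instance, no override).
attribute [local instance] charZero_placeCompletion

variable (W : WeierstrassCurve ℚ) {K : Type u} [Field K] [NumberField K]

/-- **Kolyvagin's bound on `#Ш(E/K)_{p^M}` for an ABSTRACT system of classes** (McCallum 1991, §1
Theorem, order form, upper bound, at level `M = 2M₀`): `#(S_{p^{2M₀}}(E/K) / ℤ δ x₀) ≤ p^{2M₀}` —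
VERBATIM the tree's `card_quotient_selmer_le_of_localTerm` (`HeegnerPointsKolyvaginPrimaryOrderBoundProofs`,
same displayed inputs: the classes `cl` with (A) `hcl`, `hc1`, the sign `h53`, (B) `hdual`, Čebotarev
`hC`, the Weil pairing `hW`, the Cassels–Tate inputs `e … hPτ`, Kolyvagin's annihilation `hkill`, `hL`,
McCallum's Lemma 5.3 `hloc`), except that the Heegner-point binder `IsHeegnerPoint N₀ W K Pt` is
replaced by its only use in the chain, good reduction of `E/K` at the Kolyvagin primes of level `N₀`
(`hbad`; see `KolyvaginDescentAbstractSystemValueProofs`). `Pt` is now ANY point of `E(K)` with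
`p^{M₀} x₀ = Pt` and the displayed Kummer-order data; `cl 1 = δ Pt`. So the theorem applies to Heegner
SYSTEMS transported from another curve or level. [cite: McCallumLMS1991, §1 Theorem; Thm. 5.4, Cor. 5.6]
[cite: MilneADT2006, Ch. I §6, Prop. 6.9, Thm. 6.13(a)] -/
theorem card_quotient_selmer_le_of_localTerm_of_notMemBad [W.IsElliptic] (hK : IsImaginaryQuadratic K)
    {N₀ : ℕ} [NeZero N₀] {Pt : (W.baseChange K).toAffine.Point} {p : ℕ}
    (hbad : ∀ ⦃q : ℕ⦄ (h : IsKolyvaginPrime N₀ W K p q), h.place ∉ (W.baseChange K).badPlaces (𝓞 K))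
    (hp : p.Prime) (hp2 : p ≠ 2) (hρ : W.HasSurjectiveModNGaloisRep p)
    (hC : Automorphic.chebotarev_artinRep) (hW : W.exists_weilPairing p)
    {M₀ : ℕ} (hM₀ : 1 ≤ M₀) [NeZero (p ^ M₀)]
    (hdiv : ∀ Q : geomPoints (W.baseChange K), ∃ R, ((p ^ M₀ * p ^ M₀ : ℕ) : ℤ) • R = Q)
    {c : K ≃ₐ[ℚ] K} (hc : c ≠ 1) (hcc : c * c = 1)
    {x₀ : (W.baseChange K).toAffine.Point} (hx₀ : p ^ M₀ • x₀ = Pt)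
    (hPx : kummerMapTorsion (W.baseChange K) _ hdiv Pt =
      ((p : ℤ) ^ M₀) • kummerMapTorsion (W.baseChange K) _ hdiv x₀)
    (hxord : ((p : ℤ) ^ (2 * M₀ - 1)) • kummerMapTorsion (W.baseChange K) _ hdiv x₀ ≠ 0)
    (ε : ℤ) (hε : ε = 1 ∨ ε = -1)
    (h53 : IsOfFinAddOrder (Affine.Point.map (W' := W) (c : K →ₐ[ℚ] K) Pt - ε • Pt))
    (cl : ℕ → galH1Torsion (W.baseChange K) ((p ^ M₀ * p ^ M₀ : ℕ) : ℤ))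
    (hc1 : cl 1 = kummerMapTorsion (W.baseChange K) _ hdiv Pt)
    (hcl : ∀ m : ℕ, Squarefree m →
      (∀ q ∈ m.primeFactors, IsKolyvaginPrime N₀ W K p q ∧ FrobEqFrobInfty W K (p ^ M₀ * p ^ M₀) q) →
      conjAct W c _ (cl m) = (ε * (-1) ^ m.primeFactors.card) • cl m ∧
      (∀ v : HeightOneSpectrum (𝓞 K), (m : 𝓞 K) ∉ v.asIdeal →
        cl m ∈ selmerLocalKer (W.baseChange K) (v.adicCompletion K) ((p ^ M₀ * p ^ M₀ : ℕ) : ℤ)) ∧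
      (∀ ℓ : ℕ, ℓ.Prime → ℓ ∣ m → ∀ v : HeightOneSpectrum (𝓞 K), (ℓ : 𝓞 K) ∈ v.asIdeal →
        ∀ a : ℕ, (((p : ℤ) ^ a) • cl m ∈
            selmerLocalKer (W.baseChange K) (v.adicCompletion K) ((p ^ M₀ * p ^ M₀ : ℕ) : ℤ) ↔
          ((p : ℤ) ^ a) • cl (m / ℓ) ∈
            (W.baseChange K).torsionLocalKer (v.adicCompletion K) ((p ^ M₀ * p ^ M₀ : ℕ) : ℤ))))
    (hdual : ∀ ℓ : ℕ, IsKolyvaginPrime N₀ W K p ℓ ∧ FrobEqFrobInfty W K (p ^ M₀ * p ^ M₀) ℓ →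
      ∀ ν : ℤ, (ν = 1 ∨ ν = -1) → ∀ d : galH1Torsion (W.baseChange K) ((p ^ M₀ * p ^ M₀ : ℕ) : ℤ),
      conjAct W c _ d = ν • d →
      (∀ v : HeightOneSpectrum (𝓞 K), (ℓ : 𝓞 K) ∉ v.asIdeal →
        d ∈ selmerLocalKer (W.baseChange K) (v.adicCompletion K) ((p ^ M₀ * p ^ M₀ : ℕ) : ℤ)) →
      (∀ w : InfinitePlace K,
        d ∈ selmerLocalKer (W.baseChange K) w.Completion ((p ^ M₀ * p ^ M₀ : ℕ) : ℤ)) →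
      ∀ s ∈ selmerGroup (W.baseChange K) ((p ^ M₀ * p ^ M₀ : ℕ) : ℤ), conjAct W c _ s = ν • s →
      ∀ a : ℕ, a < 2 * M₀ → ∀ v : HeightOneSpectrum (𝓞 K), (ℓ : 𝓞 K) ∈ v.asIdeal →
        ((p : ℤ) ^ a) • d ∉
          selmerLocalKer (W.baseChange K) (v.adicCompletion K) ((p ^ M₀ * p ^ M₀ : ℕ) : ℤ) →
        ((p : ℤ) ^ (2 * M₀ - 1 - a)) • s ∈
          (W.baseChange K).torsionLocalKer (v.adicCompletion K) ((p ^ M₀ * p ^ M₀ : ℕ) : ℤ))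
    -- the Cassels–Tate inputs at level `m = p^{M₀}`, auxiliary level `m² = p^M`
    (e : geomTorsion (W.baseChange K) ((p ^ M₀ * p ^ M₀ : ℕ) : ℤ) →
      geomTorsion (W.baseChange K) ((p ^ M₀ * p ^ M₀ : ℕ) : ℤ) → AlgebraicClosure K)
    (hμ : ∀ S T, e S T ^ (p ^ M₀ * p ^ M₀) = 1)
    (hadd₁ : ∀ S₁ S₂ T, e (S₁ + S₂) T = e S₁ T * e S₂ T)
    (hadd₂ : ∀ S T₁ T₂, e S (T₁ + T₂) = e S T₁ * e S T₂)
    (hgal : ∀ (σ : absoluteGaloisGroup K) (S T : geomTorsion (W.baseChange K) ((p ^ M₀ * p ^ M₀ : ℕ) : ℤ)),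
      σ • e S T = e (σ • S) (σ • T))
    (halt : ∀ T, e T T = 1)
    (inv : LocalInvariants K (p ^ M₀ * p ^ M₀)) (hPT' : inv.SumInvLocalizationEqZero)
    (hH3 : ∀ x : galoisCohomology (mu K (p ^ M₀ * p ^ M₀)) 3,
      (∀ v : Place K, galoisCohomology.localization (mu K (p ^ M₀ * p ^ M₀)) v 3 x = 0) → x = 0)
    (hB : IsLevelPairing (p ^ M₀)
      (ctLevelPairing (W.baseChange K) (p ^ M₀) e hμ hadd₁ hadd₂ hgal inv halt hPT' hH3
        (localTerm_finite_support (W := W.baseChange K) (m := p ^ M₀) (e := e) (hμ := hμ)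
          (hadd₁ := hadd₁) (hadd₂ := hadd₂) (hgal := hgal) halt inv)))
    (hPτ : ∀ z ∈ selmerGroup (W.baseChange K) ((p ^ M₀ * p ^ M₀ : ℕ) : ℤ),
      ∀ t ∈ selmerGroup (W.baseChange K) ((p ^ M₀ * p ^ M₀ : ℕ) : ℤ),
      ctGeneralFun (W.baseChange K) (p ^ M₀) e hμ hadd₁ hadd₂ hgal inv
          (torsionH1ToH1 (W.baseChange K) _ (conjAct W c _ z))
          (torsionH1ToH1 (W.baseChange K) _ (conjAct W c _ t)) =
        ctGeneralFun (W.baseChange K) (p ^ M₀) e hμ hadd₁ hadd₂ hgal inv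
          (torsionH1ToH1 (W.baseChange K) _ z) (torsionH1ToH1 (W.baseChange K) _ t))
    -- Kolyvagin's annihilation, in the two forms used
    (hkill : ∀ s ∈ selmerGroup (W.baseChange K) ((p ^ M₀ * p ^ M₀ : ℕ) : ℤ),
      ((p : ℤ) ^ M₀) • s ∈ AddSubgroup.zmultiples (kummerMapTorsion (W.baseChange K) _ hdiv x₀))
    (hL : ∀ a ∈ (W.baseChange K).sha, (((p ^ M₀ * p ^ M₀ : ℕ) : ℤ)) • a = 0 → ((p ^ M₀ : ℕ) : ℤ) • a = 0)
    -- McCallum's Lemma 5.3 for the Cassels–Tate local term at `λ`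
    (hloc : ∀ ℓ m : ℕ,
      (hℓ : IsKolyvaginPrime N₀ W K p ℓ ∧ FrobEqFrobInfty W K (p ^ M₀ * p ^ M₀) ℓ) →
      KolSupp (fun q => IsKolyvaginPrime N₀ W K p q ∧ FrobEqFrobInfty W K (p ^ M₀ * p ^ M₀) q) (ℓ * m) →
      ¬ ℓ ∣ m →
      ∀ (j N a b : ℕ) (t : galH1Torsion (W.baseChange K) ((p ^ M₀ * p ^ M₀ : ℕ) : ℤ)),
      t ∈ selmerGroup (W.baseChange K) ((p ^ M₀ * p ^ M₀ : ℕ) : ℤ) →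
      ((p : ℤ) ^ j) • cl (ℓ * m) ∈ selmerGroup (W.baseChange K) ((p ^ M₀ * p ^ M₀ : ℕ) : ℤ) →
      ((p : ℤ) ^ N) • t = 0 →
      conjAct W c ((p ^ M₀ * p ^ M₀ : ℕ) : ℤ) t = (ε * (-1) ^ (ℓ * m).primeFactors.card) • t →
      (∀ q ∈ m.primeFactors, ∀ v : HeightOneSpectrum (𝓞 K), (q : 𝓞 K) ∈ v.asIdeal →
        t ∈ (W.baseChange K).torsionLocalKer (v.adicCompletion K) ((p ^ M₀ * p ^ M₀ : ℕ) : ℤ)) →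
      M₀ ≤ j → N ≤ M₀ → N ≤ j → a + b + 1 = N →
      (¬ ∀ v : HeightOneSpectrum (𝓞 K), (ℓ : 𝓞 K) ∈ v.asIdeal →
        ((p : ℤ) ^ (a + (j - N))) • cl m ∈
          (W.baseChange K).torsionLocalKer (v.adicCompletion K) ((p ^ M₀ * p ^ M₀ : ℕ) : ℤ)) →
      (¬ ∀ v : HeightOneSpectrum (𝓞 K), (ℓ : 𝓞 K) ∈ v.asIdeal →
        ((p : ℤ) ^ b) • t ∈ (W.baseChange K).torsionLocalKer (v.adicCompletion K) ((p ^ M₀ * p ^ M₀ : ℕ) : ℤ)) →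
      ∀ D : FirstCaseData (W.baseChange K) (p ^ M₀), D.b₁ = ((p : ℤ) ^ (j - M₀)) • cl (ℓ * m) →
        galoisCohomology.map (inclKD (W.baseChange K) (p ^ M₀) (p ^ M₀)) 1 D.b' = t →
        D.localTerm e hμ hadd₁ hadd₂ hgal inv (Sum.inr hℓ.1.place) ≠ 0) :
    Nat.card (selmerGroup (W.baseChange K) ((p ^ M₀ * p ^ M₀ : ℕ) : ℤ) ⧸
        (AddSubgroup.zmultiples (kummerMapTorsion (W.baseChange K) _ hdiv x₀)).addSubgroupOf
          (selmerGroup (W.baseChange K) ((p ^ M₀ * p ^ M₀ : ℕ) : ℤ))) ≤ p ^ (2 * M₀) := by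
  have hn : p ^ M₀ * p ^ M₀ = p ^ (2 * M₀) := by rw [two_mul, pow_add]
  have hn0 : ((p ^ M₀ * p ^ M₀ : ℕ) : ℤ) ≠ 0 := by
    exact_mod_cast mul_ne_zero (NeZero.ne _) (NeZero.ne _)
  have hfin : ∀ D : GeneralCaseData (W.baseChange K) (p ^ M₀) e hμ hadd₁ hadd₂ hgal,
      ∃ S : Finset (Place K), ∀ v ∉ S, D.localTerm inv v = 0 :=
    localTerm_finite_support (W := W.baseChange K) (m := p ^ M₀) (e := e) (hμ := hμ)
      (hadd₁ := hadd₁) (hadd₂ := hadd₂) (hgal := hgal) halt inv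
  -- the descent data with its dictionary
  obtain ⟨S, hSel, hx, hSp, hSM₀, hSM, hSτ, hSKol, hSA, hSc, hSε⟩ :=
    exists_hypothesesM_of_leavesM_dictionary_level (N := N₀) hK hp hp2 hρ hC hW (M := 2 * M₀)
      (by omega) (n := p ^ M₀ * p ^ M₀) hn hdiv hc hcc hx₀ hPx hxord ε hε h53 cl hc1 hcl hdual
  haveI : Finite S.Sel := by
    rw [hSel]
    exact (W.baseChange K).finite_selmerGroup_holds hn0
  -- the Cassels–Tate pairing pulled back to `Sel`
  obtain ⟨ι, hι⟩ := exists_selmerToShaTorsion (W.baseChange K) (p ^ M₀) hL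
  let incl : S.Sel →+ selmerGroup (W.baseChange K) ((p ^ M₀ * p ^ M₀ : ℕ) : ℤ) :=
    AddSubgroup.inclusion hSel.le
  let P : S.Sel →+ S.Sel →+ AddCircle (1 : ℚ) :=
    ((ctLevelPairing (W.baseChange K) (p ^ M₀) e hμ hadd₁ hadd₂ hgal inv halt hPT' hH3 hfin).comp
      (ι.comp incl)).compl₂ (ι.comp incl)
  have hPapp : ∀ z t : S.Sel, P z t =
      ctLevelPairing (W.baseChange K) (p ^ M₀) e hμ hadd₁ hadd₂ hgal inv halt hPT' hH3 hfin
        (ι (incl z)) (ι (incl t)) := fun _ _ => rfl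
  have hincl : ∀ (v : galH1Torsion (W.baseChange K) ((p ^ M₀ * p ^ M₀ : ℕ) : ℤ)) (hv : v ∈ S.Sel),
      incl ⟨v, hv⟩ = ⟨v, hSel ▸ hv⟩ := fun _ _ => rfl
  -- `P` alternating
  have halt' : ∀ z, P z z = 0 := fun z => by rw [hPapp]; exact hB.1 _
  -- `P` is `τ`-invariant
  have hPτ' : ∀ z t : S.Sel, P ⟨S.τ z, S.τ_mem z z.2⟩ ⟨S.τ t, S.τ_mem t t.2⟩ = P z t := by
    intro z t
    rw [hPapp, hPapp]
    have key := hPτ _ (hSel.le z.2) _ (hSel.le t.2)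
    rw [ctLevelPairing_pullback_apply e hμ hadd₁ hadd₂ hgal inv halt hPT' hH3 hfin ι hι,
      ctLevelPairing_pullback_apply e hμ hadd₁ hadd₂ hgal inv halt hPT' hH3 hfin ι hι]
    change zmodToCircle _ (ctGeneralFun (W.baseChange K) (p ^ M₀) e hμ hadd₁ hadd₂ hgal inv
        (torsionH1ToH1 (W.baseChange K) ((p ^ M₀ * p ^ M₀ : ℕ) : ℤ)
          (S.τ (z : galH1Torsion (W.baseChange K) ((p ^ M₀ * p ^ M₀ : ℕ) : ℤ))))
        (torsionH1ToH1 (W.baseChange K) ((p ^ M₀ * p ^ M₀ : ℕ) : ℤ)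
          (S.τ (t : galH1Torsion (W.baseChange K) ((p ^ M₀ * p ^ M₀ : ℕ) : ℤ))))) =
      zmodToCircle _ (ctGeneralFun (W.baseChange K) (p ^ M₀) e hμ hadd₁ hadd₂ hgal inv
        (torsionH1ToH1 (W.baseChange K) ((p ^ M₀ * p ^ M₀ : ℕ) : ℤ)
          (z : galH1Torsion (W.baseChange K) ((p ^ M₀ * p ^ M₀ : ℕ) : ℤ)))
        (torsionH1ToH1 (W.baseChange K) ((p ^ M₀ * p ^ M₀ : ℕ) : ℤ)
          (t : galH1Torsion (W.baseChange K) ((p ^ M₀ * p ^ M₀ : ℕ) : ℤ))))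
    rw [hSτ, hSτ, key]
  -- `P(x, ·) = 0`
  have hPx' : ∀ t, P ⟨S.x, S.x_mem⟩ t = 0 := fun t => by
    rw [hPapp]
    refine pullback_eq_zero_of_torsionH1ToH1_eq_zero _ ι hι ?_ _
    change torsionH1ToH1 (W.baseChange K) _ S.x = 0
    rw [hx]
    exact torsionH1ToH1_kummerMapTorsion (W.baseChange K) _ hdiv x₀
  -- `hkill` for `S`
  have hkill' : ∀ t ∈ S.Sel, ((S.p : ℤ) ^ M₀) • t ∈ AddSubgroup.zmultiples S.x := by
    intro t ht
    rw [hSp, hx]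
    rw [hSel] at ht
    exact hkill t ht
  -- non-degeneracy modulo `ℤx`
  have hnd' : ∀ z : S.Sel, (∀ t, P z t = 0) → (z : galH1Torsion (W.baseChange K) _) ∈
      AddSubgroup.zmultiples S.x := by
    intro z hz
    have hall : ∀ t : selmerGroup (W.baseChange K) ((p ^ M₀ * p ^ M₀ : ℕ) : ℤ),
        ctLevelPairing (W.baseChange K) (p ^ M₀) e hμ hadd₁ hadd₂ hgal inv halt hPT' hH3 hfin
          (ι (incl z)) (ι t) = 0 := fun t => by
      have h := hz ⟨t, hSel.ge t.2⟩
      rw [hPapp] at h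
      exact h
    have h0 := torsionH1ToH1_eq_zero_of_forall_pullback_eq_zero _ ι hι hB hL hall
    rw [hx]
    exact mem_zmultiples_of_torsionH1ToH1_eq_zero_level W hK hp hp2 hρ (M := 2 * M₀) hn le_rfl
      hdiv x₀ hxord hkill h0
  -- `hCTV` from the local term at `λ`
  have hcl2 : ∀ n : ℕ, Squarefree n →
      (∀ q ∈ n.primeFactors, IsKolyvaginPrime N₀ W K p q ∧ FrobEqFrobInfty W K (p ^ M₀ * p ^ M₀) q) →
      ∀ v : HeightOneSpectrum (𝓞 K), (n : 𝓞 K) ∉ v.asIdeal →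
        cl n ∈ selmerLocalKer (W.baseChange K) (v.adicCompletion K) ((p ^ M₀ * p ^ M₀ : ℕ) : ℤ) :=
    fun n hn hq => (hcl n hn hq).2.1
  have hCTV' := HypothesesM.hCTV_of_localTerm_of_notMemBad W e hμ hadd₁ hadd₂ hgal inv halt hPT' hH3 hfin
    ι hι hK hbad hp hp2 hρ c ε cl hcl2 S hSel hSp hSM₀ hSM hSτ hSKol hSA hSc hSε hloc
  -- `hCeb` from the Čebotarev density theorem
  have hCeb' : ∀ (T : Finset (galH1Torsion (W.baseChange K) ((p ^ M₀ * p ^ M₀ : ℕ) : ℤ)))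
      (g₁ g₂ : galH1Torsion (W.baseChange K) ((p ^ M₀ * p ^ M₀ : ℕ) : ℤ)) (ν : ℤ), (ν = 1 ∨ ν = -1) →
      S.τ g₁ = ν • g₁ → S.τ g₂ = (-ν) • g₂ → (∀ t ∈ T, ∃ e : ℤ, (e = 1 ∨ e = -1) ∧ S.τ t = e • t) →
      ∀ b : ℕ, ∃ ℓ, b < ℓ ∧ S.Kol ℓ ∧
        ∀ g ∈ AddSubgroup.closure (insert g₁ (insert g₂ (T : Set _))),
          g ∈ S.A ℓ ↔ g ∈ AddSubgroup.closure (T : Set _) :=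
    fun T g₁ g₂ ν hν hg₁ hg₂ hT b =>
      S.ceb_kernel_of_dictionary_level (N := N₀) hn hC hK hp hp2 hρ hW (by omega) hc hcc hSτ
        (fun ℓ h₁ h₂ => (hSKol ℓ).mpr ⟨h₁, h₂⟩) (fun ℓ _ g => hSA ℓ g) T g₁ g₂ ν hν hg₁ hg₂ hT b
  -- the abstract bound
  have key := S.card_quotient_le_of_casselsTate P halt' hPτ' hPx' hnd' hCTV' hCeb' hkill'
    (by rw [hSM₀, hSM]; omega)
  rw [hSp, hSM₀] at key
  rw [hSel, hx] at key
  exact key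

end KolyvaginDescent

end Literature.NumberTheory.EllipticCurves

end
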